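import Summits.ValiantsHypothesis.ValiantsHypothesis.Theorems.LacunarySymmetroidMatrixDescartesCensusDefs
import Summits.ValiantsHypothesis.ValiantsHypothesis.Theorems.LacunarySymmetroidMatrixDescartesCensusLorentzRows

/-!
# `MatrixDescartes` census — the SIGNATURE REDUCTION for door A: `DoorA26` from a positive-plane law on 21-nomials

HONEST FRAMING.  Object-search cell `pub-symmetroid`; door-A item `Theses.LacunarySymmetroid.DoorA26 = PosRootLawAt 2 6 19`
(stmt-ValiantsHypothesis-19979; OPEN, typed, never asserted).  This file records, in the kernel, a SUPPORT-FREE CONDITIONAL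
REDUCTION of the door-A row (val-sym-door-p4 g8, 2026-08-28), and claims nothing unconditionally about `DoorA26`.

The mechanism.  For a real symmetric `2 × 2` pencil `F = ∑ l, X^(d l) • S l` the determinant is the pair-sum polynomial
`det F = ∑ l, ∑ l', X^(d l + d l') · N l l'` with `N l l' = S l 0 0 · S l' 1 1 − S l 0 1 · S l' 1 0`
(`det_pencil_two_eq_pairSum_X`; at a real point this is the tree's `Census.det_pencil_two_eq_pairSum`).  The quadratic form of `N`,
`u ↦ ∑ l, ∑ l', N l l' u l u l'`, is `det (∑ l, u l • S l)` and its polar form is the polarised determinant `B`; since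
`(Sym₂(ℝ), det)` is Minkowski space `ℝ^{1,2}`, this form has AT MOST ONE positive square: by the tree's reverse Cauchy–Schwarz
`Census.four_det_mul_det_le_polarDet_sq`, no 2-plane of coefficient vectors is positive definite for it.  Hence:

* `posRootLawOn_nineteen_of_posPlaneLaw` — if, on the support `d`, EVERY real `6 × 6` array `M` whose pair-sum polynomial
  `∑ l, ∑ l', X^(d l + d l') · M l l'` has at least `20` distinct positive roots admits a positive-definite 2-plane for its
  (symmetrised) quadratic form, then `ζ(2,6; d) ≤ 19` (`PosRootLawOn 2 6 19 d`);
* `doorA26_of_posPlaneLaw` — the same law on every support gives `Census.DoorA26` (`= PosRootLawAt 2 6 19`, equal by `Iff.rfl` to the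
  Theses decl).

The hypothesis («positive-plane law», the seat's conjecture Σ₆) is a statement about ABSTRACT Descartes-extremal 21-nomials on the
sumset `d ⊕ d` — most of which are not pencil determinants — and is OPEN: it is supported by exact-rational sampling of the 20-root
cell (inertia of the coefficient matrix always in `{(2,4),(3,3),(4,2)}` on ≈ 60 supports, and at the clustered limit on all 13 212
2-Sidon supports with `d₅ ≤ 30`; evidence note SIGNATURE-OBSTRUCTION-P4G8.md on the item), it is FALSE in the analogous `(2,4)`
and `(2,5)` settings (where Descartes-extremal symmetric pencils exist), and nothing here proves it for any support.  Applied to `−M`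
the law also yields a negative-definite 2-plane, so it says: the coefficient matrix of a 21-nomial with 20 positive roots has at
least two positive and at least two negative squares.  Nothing in this file bears on `DoorA34`, on the crux `MatrixDescartes`
(stmt-ValiantsHypothesis-18050) or on `VP ≠ VNP`.

[folklore] Elementary: `2 × 2` determinant expansion and reverse Cauchy–Schwarz in signature `(1,2)`.
-/

-- `Summit.ValiantsHypothesis.ValiantsHypothesis.…` repeats a component by the D-0017 layout
-- (single-conjunct summit), which the `dupNamespace` linter flags; the name is mandated.
set_option linter.dupNamespace false

namespace Summit.ValiantsHypothesis.ValiantsHypothesis.Theorems.LacunarySymmetroidMatrixDescartes.Census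

open Polynomial Matrix Finset
open scoped BigOperators Polynomial Matrix

/-- Entries of a polynomial pencil: `(∑ l, X^(d l) • (S l).map C) i j = ∑ l, X^(d l) * C (S l i j)`. [folklore] -/
theorem pencil_X_apply {m K : ℕ} (d : Fin K → ℕ) (S : Fin K → Matrix (Fin m) (Fin m) ℝ) (i j : Fin m) :
    (∑ l, (X : ℝ[X]) ^ d l • (S l).map C) i j = ∑ l, (X : ℝ[X]) ^ d l * C (S l i j) := by
  simp [Matrix.sum_apply, Matrix.smul_apply, smul_eq_mul]

/-- **Pair-sum expansion of a `2 × 2` pencil determinant, as a polynomial identity** (symmetric or not):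
`det (∑ l, X^(d l) • S l) = ∑ l, ∑ l', X^(d l + d l') · C (S l 0 0 · S l' 1 1 − S l 0 1 · S l' 1 0)`. [folklore] -/
theorem det_pencil_two_eq_pairSum_X {K : ℕ} (d : Fin K → ℕ) (S : Fin K → Matrix (Fin 2) (Fin 2) ℝ) :
    (∑ l, (X : ℝ[X]) ^ d l • (S l).map C).det =
      ∑ l, ∑ l', (X : ℝ[X]) ^ (d l + d l') * C (S l 0 0 * S l' 1 1 - S l 0 1 * S l' 1 0) := by
  rw [Matrix.det_fin_two, pencil_X_apply, pencil_X_apply, pencil_X_apply, pencil_X_apply, Finset.sum_mul_sum,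
    Finset.sum_mul_sum, ← Finset.sum_sub_distrib]
  refine Finset.sum_congr rfl fun l _ => ?_
  rw [← Finset.sum_sub_distrib]
  refine Finset.sum_congr rfl fun l' _ => ?_
  rw [pow_add, C_sub, C_mul, C_mul]
  ring

/-- The quadratic form of a pair-product array: `∑∑ (p l q l' − r l s l') u l w l' = (∑ u p)(∑ w q) − (∑ u r)(∑ w s)`. [folklore] -/
theorem sum_sum_pairForm_mul {ι : Type*} [Fintype ι] (p q r s u w : ι → ℝ) :
    ∑ l, ∑ l', (p l * q l' - r l * s l') * (u l * w l') =
      (∑ l, u l * p l) * (∑ l, w l * q l) - (∑ l, u l * r l) * (∑ l, w l * s l) := by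
  rw [Finset.sum_mul_sum, Finset.sum_mul_sum, ← Finset.sum_sub_distrib]
  refine Finset.sum_congr rfl fun l _ => ?_
  rw [← Finset.sum_sub_distrib]
  refine Finset.sum_congr rfl fun l' _ => ?_
  ring

/-- **The signature reduction on one support.**  Positive-plane law for the abstract pair-sum polynomials on `d` ⟹ the door-A row
`ζ(2,6; d) ≤ 19`.  The law asks, for every real array `M : Fin 6 → Fin 6 → ℝ` (no symmetry assumed; only its symmetrisation
enters) whose polynomial `∑ l, ∑ l', X^(d l + d l') · M l l'` has `≥ 20` distinct positive roots, for two coefficient vectors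
`u, v` spanning a positive-definite 2-plane of the quadratic form `u ↦ ∑∑ M l l' u l u l'`
(`0 < Q(u)` and `(2B(u,v))² < 4 Q(u) Q(v)` with `2B(u,v) = ∑∑ M l l' (u l v l' + v l u l')`).  For the array of a symmetric pencil
this contradicts reverse Cauchy–Schwarz in `(Sym₂(ℝ), det) ≅ ℝ^{1,2}`. [folklore] -/
theorem posRootLawOn_nineteen_of_posPlaneLaw (d : Fin 6 → ℕ)
    (hLaw : ∀ M : Fin 6 → Fin 6 → ℝ,
      20 ≤ ((∑ l, ∑ l', (X : ℝ[X]) ^ (d l + d l') * C (M l l')).roots.toFinset.filter (fun t => 0 < t)).card →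
        ∃ u v : Fin 6 → ℝ, 0 < ∑ l, ∑ l', M l l' * (u l * u l') ∧
          (∑ l, ∑ l', M l l' * (u l * v l' + v l * u l')) ^ 2 <
            4 * (∑ l, ∑ l', M l l' * (u l * u l')) * (∑ l, ∑ l', M l l' * (v l * v l'))) :
    PosRootLawOn 2 6 19 d := by
  intro S hS
  by_contra h20
  have h20' : 20 ≤ ((∑ l, (X : ℝ[X]) ^ d l • (S l).map C).det.roots.toFinset.filter (fun t => 0 < t)).card := by
    omega
  rw [det_pencil_two_eq_pairSum_X] at h20'
  obtain ⟨u, v, hQ, hB⟩ := hLaw (fun l l' => S l 0 0 * S l' 1 1 - S l 0 1 * S l' 1 0) h20'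
  -- symmetry of the letters: `S l 1 0 = S l 0 1`
  have hsym : ∀ l, S l 1 0 = S l 0 1 := fun l => by
    have := hS l
    exact (Matrix.IsSymm.apply this 0 1)
  -- the three entry sums of `U = ∑ u l • S l` and `V = ∑ v l • S l`
  set α := ∑ l, u l * S l 0 0 with hα
  set β := ∑ l, u l * S l 0 1 with hβ
  set γ := ∑ l, u l * S l 1 1 with hγ
  set α' := ∑ l, v l * S l 0 0 with hα'
  set β' := ∑ l, v l * S l 0 1 with hβ'
  set γ' := ∑ l, v l * S l 1 1 with hγ'
  have h10u : ∑ l, u l * S l 1 0 = β := by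
    rw [hβ]; exact Finset.sum_congr rfl fun l _ => by rw [hsym l]
  have h10v : ∑ l, v l * S l 1 0 = β' := by
    rw [hβ']; exact Finset.sum_congr rfl fun l _ => by rw [hsym l]
  have hQu : ∑ l, ∑ l', (S l 0 0 * S l' 1 1 - S l 0 1 * S l' 1 0) * (u l * u l') = α * γ - β ^ 2 := by
    rw [sum_sum_pairForm_mul, h10u, ← hα, ← hβ, ← hγ]; ring
  have hQv : ∑ l, ∑ l', (S l 0 0 * S l' 1 1 - S l 0 1 * S l' 1 0) * (v l * v l') = α' * γ' - β' ^ 2 := by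
    rw [sum_sum_pairForm_mul, h10v, ← hα', ← hβ', ← hγ']; ring
  have hBuv : ∑ l, ∑ l', (S l 0 0 * S l' 1 1 - S l 0 1 * S l' 1 0) * (u l * v l' + v l * u l') =
      α * γ' + γ * α' - 2 * (β * β') := by
    have hsplit : ∑ l, ∑ l', (S l 0 0 * S l' 1 1 - S l 0 1 * S l' 1 0) * (u l * v l' + v l * u l') =
        ∑ l, ∑ l', (S l 0 0 * S l' 1 1 - S l 0 1 * S l' 1 0) * (u l * v l') +
          ∑ l, ∑ l', (S l 0 0 * S l' 1 1 - S l 0 1 * S l' 1 0) * (v l * u l') := by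
      rw [← Finset.sum_add_distrib]
      refine Finset.sum_congr rfl fun l _ => ?_
      rw [← Finset.sum_add_distrib]
      refine Finset.sum_congr rfl fun l' _ => ?_
      ring
    rw [hsplit, sum_sum_pairForm_mul, sum_sum_pairForm_mul, h10u, h10v, ← hα, ← hβ, ← hγ, ← hα', ← hβ', ← hγ']
    ring
  rw [hQu] at hQ hB
  rw [hQv, hBuv] at hB
  have hP := four_det_mul_det_le_polarDet_sq α β γ α' β' γ' hQ
  linarith

/-- **Door A from the positive-plane law** (support-free conditional reduction): if on every support `d : Fin 6 → ℕ` every real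
array whose pair-sum polynomial has at least `20` distinct positive roots carries a positive-definite 2-plane of its quadratic form,
then `Census.DoorA26` (`= PosRootLawAt 2 6 19`, the Theses decl by `Iff.rfl`).  The hypothesis is the seat's conjecture Σ₆ (OPEN);
nothing unconditional about `DoorA26` is claimed. [folklore] -/
theorem doorA26_of_posPlaneLaw
    (hLaw : ∀ (d : Fin 6 → ℕ) (M : Fin 6 → Fin 6 → ℝ),
      20 ≤ ((∑ l, ∑ l', (X : ℝ[X]) ^ (d l + d l') * C (M l l')).roots.toFinset.filter (fun t => 0 < t)).card →
        ∃ u v : Fin 6 → ℝ, 0 < ∑ l, ∑ l', M l l' * (u l * u l') ∧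
          (∑ l, ∑ l', M l l' * (u l * v l' + v l * u l')) ^ 2 <
            4 * (∑ l, ∑ l', M l l' * (u l * u l')) * (∑ l, ∑ l', M l l' * (v l * v l'))) :
    DoorA26 := by
  intro d S hS
  exact posRootLawOn_nineteen_of_posPlaneLaw d (hLaw d) S hS

end Summit.ValiantsHypothesis.ValiantsHypothesis.Theorems.LacunarySymmetroidMatrixDescartes.Census
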